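import Summits.Ventures.HodgeRepro2.T6B1Main
import Summits.Ventures.HodgeRepro2.T6B1Fields

/-!
# T6B1Bridge — `B1_main` on the CM field of the route (Tier-6 sub-goal B1, proof lane)

Glue between (B1.a) and (B1.b)–(B1.d): for the host's CM field `F` (`IsCMField F`), O'Meara's datum `θ ∈ F⁺` of
`T6B1Fields.exists_theta` is negative at every real place of `F⁺` in the sense of `T6B1Carriers.realOf` (the
embedding `F⁺ → ℝ` at `w` extends to a complex embedding of `F`, which sends `θ` to a negative real), so `B1_main`
applies with `K := F⁺`: `B1_main_cm`.
-/

namespace Summit.Ventures.HodgeRepro2.T6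
namespace B1Bridge

open NumberField B1Carriers B1Construct B1Fields B1Main
open scoped ComplexOrder

variable (F : Type*) [Field F] [NumberField F] [IsCMField F]

/-- `realOf` at a real place `w`, as a complex number, is the value of `w.embedding`. -/
theorem coe_realOf {K : Type*} [Field K] {w : InfinitePlace K} (hw : w.IsReal) (x : K) :
    ((realOf K hw x : ℝ) : ℂ) = w.embedding x := by
  unfold realOf
  rw [InfinitePlace.Completion.ringEquivRealOfIsReal_apply]
  have := InfinitePlace.Completion.extensionEmbeddingOfIsReal_coe hw ((WithAbs.equiv w.1).symm x)
  simp only [WithAbs.equiv_symm_apply] at this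
  erw [this]
  rw [InfinitePlace.embedding_of_isReal_apply]
  rfl

/-- An element of `F⁺` that is negative under every complex embedding of `F` is negative at every real place of
`F⁺` (`realOf`): extend `w.embedding : F⁺ → ℂ` to `F` by `IsAlgClosed.lift`. -/
theorem realOf_neg_of_forall_embedding (θ : maximalRealSubfield F)
    (h : ∀ φ : F →+* ℂ, (φ (θ : F)).re < 0 ∧ (φ (θ : F)).im = 0)
    (w : InfinitePlace (maximalRealSubfield F)) (hw : w.IsReal) : realOf (maximalRealSubfield F) hw θ < 0 := by
  letI : Algebra (maximalRealSubfield F) ℂ := w.embedding.toAlgebra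
  let ψ : F →ₐ[maximalRealSubfield F] ℂ := IsAlgClosed.lift
  have hψ : ψ.toRingHom (θ : F) = w.embedding θ := by
    have := ψ.commutes θ
    rw [RingHom.algebraMap_toAlgebra] at this
    exact this
  have hre := (h ψ.toRingHom).1
  rw [hψ, ← coe_realOf, Complex.ofReal_re] at hre
  exact hre

/-- **B1 on the route's CM field.** For a CM field `F` with maximal real subfield `F⁺` and a real place `τ` of `F⁺`,
assuming the three displayed theorems of O'Meara for `F⁺`: there is O'Meara's datum `θ ∈ F⁺` (a non-square with
`F ≃ₐ[F⁺] F⁺(√θ)`, negative at every real place) and, for it, the totally positive definite incoherent `𝕍` of rank `3`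
over `A_E` with its `τ`-nearby `W` of signature `(2, 1)` at `τ` and positive definite elsewhere — (B1.a)–(B1.d). -/
theorem B1_main_cm {τ : InfinitePlace (maximalRealSubfield F)} (hτ : τ.IsReal)
    (h1 : Hyp.OMeara1963_65_15 (maximalRealSubfield F)) (h2 : Hyp.OMeara1963_71_18 (maximalRealSubfield F))
    (h3 : Hyp.OMeara1963_71_19 (maximalRealSubfield F)) :
    ∃ θ : maximalRealSubfield F, ¬ IsSquare θ ∧
      Nonempty (QuadraticAlgebra (maximalRealSubfield F) θ 0 ≃ₐ[maximalRealSubfield F] F) ∧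
      (∀ (w : InfinitePlace (maximalRealSubfield F)) (hw : w.IsReal), realOf (maximalRealSubfield F) hw θ < 0) ∧
      ∃ 𝕍 : AdelicHermitianSpace (maximalRealSubfield F) θ 3,
        IsTotallyPositiveDefinite (maximalRealSubfield F) 𝕍 ∧ IsIncoherentSpace (maximalRealSubfield F) 𝕍 ∧
        ∃ W : GlobalHermitianSpace (maximalRealSubfield F) θ 3, IsNearbyAt (maximalRealSubfield F) hτ 𝕍 W ∧
          (∀ (w : InfinitePlace (maximalRealSubfield F)) (hw : w.IsReal), w ≠ τ →
            (globalGramAt (maximalRealSubfield F) W hw).PosDef) ∧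
          HasSig (globalGramAt (maximalRealSubfield F) W hτ) 2 1 := by
  obtain ⟨θ, hθ, hneg, hiso⟩ := exists_theta F
  have hneg' := realOf_neg_of_forall_embedding F θ hneg
  exact ⟨θ, hθ, hiso, hneg', B1_main (maximalRealSubfield F) θ hθ hneg' hτ h1 h2 h3⟩

end B1Bridge
end Summit.Ventures.HodgeRepro2.T6
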